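import Summits.HodgeConjecture.HodgeConjecture.Theorems.R90S6TwistedShellCountRankOne          -- ★ W11 FILE 2: `thetaTreeIso_root`, `glVertexAct_thetaTreeIso_glVertexAct_thetaTreeIso` (τ_δ² = Nδ•), `thetaTreeIso_trans_glTreeIso_apply` (brings FILE 1 ∕ 1b, (W1c)-A)
import Summits.HodgeConjecture.HodgeConjecture.Theorems.R90S6TreeInversionDisplacement          -- ★ W8-f′ «INVERSION EDITION» (K2E3-p28, p864951): `dist_self_apply_eq_of_inversion`, `ncard_dist_self_apply_eq_odd_of_inversion`, …
import Literature.NumberTheory.Automorphic.SLTwoTreeQuadraticTorusShellCount                   -- ★ `isSelfDualLattice_glVertexAct_iff_of_valuation_det_eq_one`, `…_iff_not_of_valuation_det_eq` (type kept ∕ swapped)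
import Literature.Combinatorics.SimpleGraph.TreeAutomorphismFiniteInvariantFacet               -- ★ `RootedTree.exists_fixed_or_swap_adj_of_sq_apply_eq` (α² fixes a vertex ⇒ α fixes a vertex or inverts an edge)
import HarnessLib

/-!
# R90 · S6 «Ch. 14.1–14.5 stable TF» — card W11, FILE 2b: THE PARITY OF `ord det δ` — `τ_δ` FIXES A VERTEX (even) OR INVERTS AN EDGE (odd); THE INVERSION SHELLS
# (`Theorems/R90S6TwistedShellParityRankOne.lean`; DAG E1.4.4.3.2)

Cell `hodgecm-mathlib`, crux H413 (`stmt-HodgeConjecture-24833`), route of record `HCCMUnconditional`; programme R90-TF, section S6 (base `R90-C14`),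
seat K2Liu-p27 (g4); S6 dealer R90-C14-plan (g2) CARD W11 (02:43:57Z; «FILE 2b imports K2E3-p28's inversion edition» 03:01:08Z), dealer (g3) RULINGS #1 (R1)
03:36:32Z.  Sequel of ★ FILE 2 `R90S6TwistedShellCountRankOne` (the elliptic count for `τ_δ` WITH a fixed vertex).  Lane `--supports stmt-HodgeConjecture-24833
--as helper`; THEOREMS ONLY (no definition, no instance, no notation, no named-fact hypothesis, no `sorry`).

THE MATHEMATICS (Rogawski §4.11 pp. 58–60, the sign `(−1)^{ord det δ}` of §4.10–4.11; Langlands, *Base change for GL(2)* §5; Serre, *Trees* I.6.1, I.6.4–6.5, II.1.2–1.3).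
On the tree `X` of `GL₂(E)` the vertex types (`J`-self-dual ∕ `J`-`ϖ`-modular) form the proper 2-colouring; `g•` shifts the type by `ord det g (mod 2)` and `θ̄` keeps it
(★ (T.2)), so the twisted displacement map `τ_δ = δ• ∘ θ̄` shifts types by `ord det δ (mod 2)` (`ord det δ = n` is carried by the binder `hδ : |det δ| = |ϖⁿ|`, `n ∈ ℤ`):
* §1 **`isSelfDualLattice_glVertexAct_iff_of_valuation_det_eq`**: `(g•M) self-dual ↔ (M self-dual ↔ n even)`; **`isSelfDualLattice_glVertexAct_thetaTreeIso_iff`** (same for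
  `τ_δ`); **`glVertexAct_thetaTreeIso_ne_self_of_odd`**: `n` odd ⇒ `τ_δ` has NO fixed vertex.
* §2 THE DICHOTOMY for an ELLIPTIC norm (binder `hx : (δ·Θδ) • x = x` — the norm `Nδ = δΘ(δ)` fixes a vertex; `τ_δ² = Nδ•` by ★ FILE 2): ★ `exists_fixed_or_swap_adj_of_sq_apply_eq`
  gives **`exists_glVertexAct_thetaTreeIso_eq_self_or_swap`**; a swapped edge joins vertices of different types, so **`exists_glVertexAct_thetaTreeIso_eq_self_of_even`**
  (`n` even ⇒ `τ_δ` fixes a vertex — FILE 2 §3 applies) and **`exists_swap_of_odd`** (`n` odd ⇒ `τ_δ` INVERTS an edge `y ~ y′`: the twisted centraliser is the anisotropic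
  `U(2)`, fixing the midpoint).
* §3 THE INVERSION SHELLS — ★ W8-f′ (K2E3-p28) BY NAME at `φ = τ_δ`: **`dist_glVertexAct_thetaTreeIso_eq_of_swap`** (`d(x, τ_δ x) = 2·min(d(x,y), d(x,y′)) + 1`, every displacement
  odd), **`setOf_dist_glVertexAct_thetaTreeIso_eq_even_of_swap`** (`= ∅`), **`ncard_setOf_dist_glVertexAct_thetaTreeIso_eq_odd_of_swap`** (`#{x : d(x, τ_δ x) = 2k+1} = 2·q^k`
  on the `(q+1)`-regular tree, regularity as the VALUE BINDER `hdeg`).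
HONEST LABEL: count layer of E1.4.4.3.2 (the `G̃`-side of the η̂_j clauses, Prop. 4.11.1 (b) ∕ L. 11.5.3), count-neutral until the socket consumes it; proves no printed global
statement; HC_CM is proved only modulo the 7 printed citations (2 remaining named inputs: hLiu418 = stmt-HodgeConjecture-24832, h413 = stmt-HodgeConjecture-24833) until rung 0
closes; REL ≠ ★ ≠ BUILT.

## References
* [Rogawski1990] J. D. Rogawski, *Automorphic Representations of Unitary Groups in Three Variables*, Ann. of Math. Stud. 123 (1990), §4.10–§4.11 pp. 56–60, L. 11.5.3 p. 155.
* [Langlands1980AMS96] R. P. Langlands, *Base Change for GL(2)*, Ann. of Math. Stud. 96 (1980), §4–§5.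
* [Serre1980Trees] J.-P. Serre, *Trees* (1980), Ch. I §6.1, §6.4 Prop. 25, §6.5 Prop. 19; Ch. II §1.2–§1.3.
* [Meier2008] J. Meier, *Groups, Graphs and Trees* (2008), Thm. 3.46.
-/

set_option autoImplicit false
-- the mandated namespace repeats the single-problem summit's segment (`HodgeConjecture.HodgeConjecture`)
set_option linter.dupNamespace false

noncomputable section

open scoped ValuativeRel Matrix MatrixGroups
open Matrix ValuativeRel
open Literature.NumberTheory.Automorphic Literature.NumberTheory.Automorphic.HermitianLatticeTree
open Literature.Combinatorics.SimpleGraph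

namespace Summit.HodgeConjecture.HodgeConjecture.R90.S6

variable {E : Type*} [Field E] [ValuativeRel E] {ϖ : E} (hϖ : IsUniformizingElement ϖ) [IsDiscreteValuationRing 𝒪[E]]

/-! ## §1 `g•` shifts the vertex type by `ord det g (mod 2)`; `τ_δ` by `ord det δ (mod 2)` -/

section Parity

omit [IsDiscreteValuationRing 𝒪[E]] in
include hϖ in
/-- `|ϖᵃ| = |ϖᵇ| ⇒ a = b` (★ `IsUniformizingElement.eq_zero_of_zpow_mem`). [folklore] -/
private theorem zpow_injective_valuation {a b : ℤ} (h : valuation E (ϖ ^ a) = valuation E (ϖ ^ b)) : a = b := by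
  have h0 := hϖ.ne_zero
  have hb0 : valuation E (ϖ ^ b) ≠ 0 := (Valuation.ne_zero_iff _).2 (zpow_ne_zero b h0)
  have hab : valuation E (ϖ ^ (a - b)) = 1 := by
    rw [zpow_sub₀ h0, map_div₀, h, div_self hb0]
  have h1 : ϖ ^ (a - b) ∈ 𝒪[E] := (Valuation.mem_integer_iff _ _).2 hab.le
  have h2 : ϖ ^ (-(a - b)) ∈ 𝒪[E] := (Valuation.mem_integer_iff _ _).2 (by rw [_root_.zpow_neg, map_inv₀, hab, inv_one])
  have := hϖ.eq_zero_of_zpow_mem h1 h2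
  omega

omit [ValuativeRel E] [IsDiscreteValuationRing 𝒪[E]] in
/-- `det ((c • 1) g′) = c² det g′`. [folklore] -/
private theorem det_map_scalar_mul_two (c : Eˣ) (g' : GL (Fin 2) E) :
    ((c.map ((Matrix.scalar (Fin 2) : E →+* Matrix (Fin 2) (Fin 2) E) : E →* Matrix (Fin 2) (Fin 2) E) * g' : GL (Fin 2) E) : Matrix (Fin 2) (Fin 2) E).det =
      (c : E) ^ 2 * (g' : Matrix (Fin 2) (Fin 2) E).det := by
  rw [Units.val_mul, Units.coe_map, MonoidHom.coe_coe, Matrix.det_mul, Matrix.scalar_apply, Matrix.det_diagonal, Fin.prod_const]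

include hϖ in
/-- **`g•` SHIFTS THE VERTEX TYPE BY `ord det g (mod 2)`**: if `|det g| = |ϖⁿ|` then `g • M` is `J`-self-dual iff (`M` is `J`-self-dual ↔ `n` even).  Proof: `g = (c•1)·g′` with
`|det g′| ∈ {1, |ϖ|}` (★ `exists_eq_scalar_mul_valuation_det`); homotheties act trivially (★ `glVertexAct_scalar_mul`); `g′` keeps ∕ swaps the type (★
`isSelfDualLattice_glVertexAct_iff_of_valuation_det_eq_one` ∕ `…_iff_not_of_valuation_det_eq`); and `n = 2·ord c + ord det g′`. [cite: Serre1980Trees, Ch. II §1.2–§1.3] -/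
theorem isSelfDualLattice_glVertexAct_iff_of_valuation_det_eq (g : GL (Fin 2) E) {n : ℤ}
    (hg : valuation E (g : Matrix (Fin 2) (Fin 2) E).det = valuation E (ϖ ^ n))
    (M : {M : Submodule 𝒪[E] (Fin 2 → E) // IsSpecialLattice (RingHom.id E) ϖ !![(0 : E), 1; -1, 0] M}) :
    IsSelfDualLattice (RingHom.id E) !![(0 : E), 1; -1, 0] (glVertexAct hϖ g M).1 ↔
      (IsSelfDualLattice (RingHom.id E) !![(0 : E), 1; -1, 0] M.1 ↔ Even n) := by
  have h0 := hϖ.ne_zero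
  obtain ⟨c, g', rfl, hdet⟩ := exists_eq_scalar_mul_valuation_det hϖ g
  obtain ⟨a, e, he, hce⟩ := exists_eq_zpow_mul_of_ne_zero hϖ c.ne_zero
  rw [glVertexAct_scalar_mul]
  rw [det_map_scalar_mul_two, map_mul, map_pow, hce, map_mul, he, mul_one] at hg
  rcases hdet with h1 | hϖ1
  · -- `|det g′| = 1`: type kept, `n = 2a`
    rw [h1, mul_one, ← map_pow, ← zpow_natCast, ← _root_.zpow_mul] at hg
    have hn : n = a * (2 : ℕ) := (zpow_injective_valuation hϖ hg).symm
    have heven : Even n := ⟨a, by rw [hn]; push_cast; ring⟩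
    rw [iff_true_right heven]
    exact isSelfDualLattice_glVertexAct_iff_of_valuation_det_eq_one hϖ h1 M
  · -- `|det g′| = |ϖ|`: type swapped, `n = 2a + 1`
    rw [hϖ1, ← map_pow, ← map_mul, ← zpow_natCast, ← _root_.zpow_mul, ← zpow_add_one₀ h0] at hg
    have hn : n = a * (2 : ℕ) + 1 := (zpow_injective_valuation hϖ hg).symm
    have hodd : ¬ Even n := by
      rw [Int.not_even_iff_odd]
      exact ⟨a, by rw [hn]; push_cast; ring⟩
    rw [iff_false_right hodd]
    exact isSelfDualLattice_glVertexAct_iff_not_of_valuation_det_eq hϖ hϖ1 M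

variable (σ : E →+* E) (hσv : ∀ x : E, valuation E (σ x) = valuation E x) (hσσ : ∀ x : E, σ (σ x) = x)

include hϖ in
/-- **`τ_δ = δ• ∘ θ̄` SHIFTS THE VERTEX TYPE BY `ord det δ (mod 2)`** (`θ̄` keeps the type, ★ (T.2) `isSelfDualLattice_thetaTreeIso_iff`). [cite: Rogawski1990, §4.11 pp. 58–60]
[cite: Serre1980Trees, Ch. II §1.2–§1.3] -/
theorem isSelfDualLattice_glVertexAct_thetaTreeIso_iff (δ : GL (Fin 2) E) {n : ℤ}
    (hδ : valuation E (δ : Matrix (Fin 2) (Fin 2) E).det = valuation E (ϖ ^ n))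
    (M : {M : Submodule 𝒪[E] (Fin 2 → E) // IsSpecialLattice (RingHom.id E) ϖ !![(0 : E), 1; -1, 0] M}) :
    IsSelfDualLattice (RingHom.id E) !![(0 : E), 1; -1, 0] (glVertexAct hϖ δ (thetaTreeIso hϖ σ hσv hσσ M)).1 ↔
      (IsSelfDualLattice (RingHom.id E) !![(0 : E), 1; -1, 0] M.1 ↔ Even n) := by
  rw [isSelfDualLattice_glVertexAct_iff_of_valuation_det_eq hϖ δ hδ, isSelfDualLattice_thetaTreeIso_iff]

include hϖ in
/-- **`ord det δ` ODD ⇒ `τ_δ` HAS NO FIXED VERTEX** (a fixed vertex would have the type of its image). [cite: Rogawski1990, §4.11 pp. 58–60] [cite: Serre1980Trees, Ch. I §6.1] -/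
theorem glVertexAct_thetaTreeIso_ne_self_of_odd (δ : GL (Fin 2) E) {n : ℤ}
    (hδ : valuation E (δ : Matrix (Fin 2) (Fin 2) E).det = valuation E (ϖ ^ n)) (hn : Odd n)
    (M : {M : Submodule 𝒪[E] (Fin 2 → E) // IsSpecialLattice (RingHom.id E) ϖ !![(0 : E), 1; -1, 0] M}) :
    glVertexAct hϖ δ (thetaTreeIso hϖ σ hσv hσσ M) ≠ M := by
  intro h
  have hiff := isSelfDualLattice_glVertexAct_thetaTreeIso_iff hϖ σ hσv hσσ δ hδ M
  rw [h, iff_false_right (Int.not_even_iff_odd.2 hn)] at hiff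
  exact iff_not_self hiff

end Parity

/-! ## §2 The dichotomy for an elliptic norm: a fixed vertex (`ord det δ` even) or an inverted edge (`ord det δ` odd) -/

section Dichotomy

variable (σ : E →+* E) (hσv : ∀ x : E, valuation E (σ x) = valuation E x) (hσσ : ∀ x : E, σ (σ x) = x)

omit [IsDiscreteValuationRing 𝒪[E]] in
include hϖ in
/-- Adjacent vertices of the tree of `GL₂(E)` have different types (★ `latticeTree_adj_iff` + ★ `not_isModularLattice_of_isSelfDualLattice`). [cite: Serre1980Trees, Ch. II §1.1] -/
private theorem isSelfDualLattice_iff_not_of_adj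
    {M N : {M : Submodule 𝒪[E] (Fin 2 → E) // IsSpecialLattice (RingHom.id E) ϖ !![(0 : E), 1; -1, 0] M}}
    (h : (latticeTree (RingHom.id E) ϖ !![(0 : E), 1; -1, 0]).Adj M N) :
    IsSelfDualLattice (RingHom.id E) !![(0 : E), 1; -1, 0] M.1 ↔ ¬ IsSelfDualLattice (RingHom.id E) !![(0 : E), 1; -1, 0] N.1 := by
  rw [latticeTree_adj_iff] at h
  obtain ⟨-, hMN | hNM⟩ := h
  · exact ⟨fun _ hN => not_isModularLattice_of_isSelfDualLattice (RingHom.id E) (fun _ => rfl) hϖ _ hN hMN.2.1, fun _ => hMN.1⟩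
  · exact ⟨fun hM _ => not_isModularLattice_of_isSelfDualLattice (RingHom.id E) (fun _ => rfl) hϖ _ hM hNM.2.1, fun hN => absurd hNM.1 hN⟩

/-- **THE DICHOTOMY**: if the norm `Nδ = δ Θ(δ)` fixes a vertex `x` (an ELLIPTIC twisted class), then `τ_δ` fixes a vertex or inverts an edge — `τ_δ² = Nδ•` (★ FILE 2) and a tree
automorphism whose square fixes a vertex fixes a vertex or inverts an edge (★ `exists_fixed_or_swap_adj_of_sq_apply_eq`). [cite: Serre1980Trees, Ch. I §6.5 Prop. 19] [cite: Meier2008, Thm. 3.46] -/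
theorem exists_glVertexAct_thetaTreeIso_eq_self_or_swap (δ : GL (Fin 2) E)
    {x : {M : Submodule 𝒪[E] (Fin 2 → E) // IsSpecialLattice (RingHom.id E) ϖ !![(0 : E), 1; -1, 0] M}}
    (hx : glVertexAct hϖ (δ * UnitaryGroup.qsInvolution σ δ) x = x) :
    (∃ v : {M : Submodule 𝒪[E] (Fin 2 → E) // IsSpecialLattice (RingHom.id E) ϖ !![(0 : E), 1; -1, 0] M},
        glVertexAct hϖ δ (thetaTreeIso hϖ σ hσv hσσ v) = v) ∨
      ∃ u v : {M : Submodule 𝒪[E] (Fin 2 → E) // IsSpecialLattice (RingHom.id E) ϖ !![(0 : E), 1; -1, 0] M},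
        (latticeTree (RingHom.id E) ϖ !![(0 : E), 1; -1, 0]).Adj u v ∧
          glVertexAct hϖ δ (thetaTreeIso hϖ σ hσv hσσ u) = v ∧ glVertexAct hϖ δ (thetaTreeIso hϖ σ hσv hσσ v) = u := by
  have hsq : ((thetaTreeIso hϖ σ hσv hσσ).trans (glTreeIso hϖ δ)) (((thetaTreeIso hϖ σ hσv hσσ).trans (glTreeIso hϖ δ)) x) = x := by
    rw [thetaTreeIso_trans_glTreeIso_apply, thetaTreeIso_trans_glTreeIso_apply, glVertexAct_thetaTreeIso_glVertexAct_thetaTreeIso, hx]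
  exact RootedTree.exists_fixed_or_swap_adj_of_sq_apply_eq (isTree_latticeTree_id_altJ hϖ) _ hsq

/-- **`ord det δ` EVEN and `Nδ` elliptic ⇒ `τ_δ` FIXES A VERTEX** (an inverted edge would join two vertices of the same type-shift class — impossible, adjacent vertices have
different types).  Then ★ FILE 2 §3 counts the shells `#{x : d(x, τ_δ x) = 2k}` off `Fix τ_δ`. [cite: Rogawski1990, §4.11 pp. 58–60] [cite: Serre1980Trees, Ch. I §6.1, §6.5] -/
theorem exists_glVertexAct_thetaTreeIso_eq_self_of_even (δ : GL (Fin 2) E) {n : ℤ}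
    (hδ : valuation E (δ : Matrix (Fin 2) (Fin 2) E).det = valuation E (ϖ ^ n)) (hn : Even n)
    {x : {M : Submodule 𝒪[E] (Fin 2 → E) // IsSpecialLattice (RingHom.id E) ϖ !![(0 : E), 1; -1, 0] M}}
    (hx : glVertexAct hϖ (δ * UnitaryGroup.qsInvolution σ δ) x = x) :
    ∃ v : {M : Submodule 𝒪[E] (Fin 2 → E) // IsSpecialLattice (RingHom.id E) ϖ !![(0 : E), 1; -1, 0] M},
      glVertexAct hϖ δ (thetaTreeIso hϖ σ hσv hσσ v) = v := by
  rcases exists_glVertexAct_thetaTreeIso_eq_self_or_swap hϖ σ hσv hσσ δ hx with h | ⟨u, v, huv, hu, -⟩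
  · exact h
  · exfalso
    have htype := isSelfDualLattice_glVertexAct_thetaTreeIso_iff hϖ σ hσv hσσ δ hδ u
    rw [hu, iff_true_right hn] at htype
    exact iff_not_self (htype.trans (isSelfDualLattice_iff_not_of_adj hϖ huv))

/-- **`ord det δ` ODD and `Nδ` elliptic ⇒ `τ_δ` INVERTS AN EDGE `y ~ y′`** (no fixed vertex by §1, so the dichotomy leaves the inversion): the twisted centraliser is the
anisotropic unitary group, fixing the midpoint of the edge; ★ W8-f′ counts the shells off it (§3). [cite: Rogawski1990, §4.11 pp. 58–60] [cite: Serre1980Trees, Ch. I §6.1, §6.5] -/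
theorem exists_swap_of_odd (δ : GL (Fin 2) E) {n : ℤ}
    (hδ : valuation E (δ : Matrix (Fin 2) (Fin 2) E).det = valuation E (ϖ ^ n)) (hn : Odd n)
    {x : {M : Submodule 𝒪[E] (Fin 2 → E) // IsSpecialLattice (RingHom.id E) ϖ !![(0 : E), 1; -1, 0] M}}
    (hx : glVertexAct hϖ (δ * UnitaryGroup.qsInvolution σ δ) x = x) :
    ∃ y y' : {M : Submodule 𝒪[E] (Fin 2 → E) // IsSpecialLattice (RingHom.id E) ϖ !![(0 : E), 1; -1, 0] M},
      (latticeTree (RingHom.id E) ϖ !![(0 : E), 1; -1, 0]).Adj y y' ∧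
        glVertexAct hϖ δ (thetaTreeIso hϖ σ hσv hσσ y) = y' ∧ glVertexAct hϖ δ (thetaTreeIso hϖ σ hσv hσσ y') = y := by
  rcases exists_glVertexAct_thetaTreeIso_eq_self_or_swap hϖ σ hσv hσσ δ hx with ⟨v, hv⟩ | h
  · exact absurd hv (glVertexAct_thetaTreeIso_ne_self_of_odd hϖ σ hσv hσσ δ hδ hn v)
  · exact h

end Dichotomy

/-! ## §3 The inversion shells (★ W8-f′ «INVERSION EDITION» at `φ = τ_δ`) -/

section Inversion

variable (σ : E →+* E) (hσv : ∀ x : E, valuation E (σ x) = valuation E x) (hσσ : ∀ x : E, σ (σ x) = x)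

/-- **(I.1 at `τ_δ`) `d(x, τ_δ x) = 2·min(d(x,y), d(x,y′)) + 1`** when `τ_δ` inverts the edge `y ~ y′` — every twisted displacement is ODD (★ `dist_self_apply_eq_of_inversion`).
[cite: Serre1980Trees, Ch. I §6.4 Prop. 25] -/
theorem dist_glVertexAct_thetaTreeIso_eq_of_swap (δ : GL (Fin 2) E)
    {y y' : {M : Submodule 𝒪[E] (Fin 2 → E) // IsSpecialLattice (RingHom.id E) ϖ !![(0 : E), 1; -1, 0] M}}
    (hyy' : (latticeTree (RingHom.id E) ϖ !![(0 : E), 1; -1, 0]).Adj y y')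
    (hy : glVertexAct hϖ δ (thetaTreeIso hϖ σ hσv hσσ y) = y') (hy' : glVertexAct hϖ δ (thetaTreeIso hϖ σ hσv hσσ y') = y)
    (x : {M : Submodule 𝒪[E] (Fin 2 → E) // IsSpecialLattice (RingHom.id E) ϖ !![(0 : E), 1; -1, 0] M}) :
    (latticeTree (RingHom.id E) ϖ !![(0 : E), 1; -1, 0]).dist x (glVertexAct hϖ δ (thetaTreeIso hϖ σ hσv hσσ x)) =
      2 * min ((latticeTree (RingHom.id E) ϖ !![(0 : E), 1; -1, 0]).dist x y) ((latticeTree (RingHom.id E) ϖ !![(0 : E), 1; -1, 0]).dist x y') + 1 :=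
  dist_self_apply_eq_of_inversion (isTree_latticeTree_id_altJ hϖ) ((thetaTreeIso hϖ σ hσv hσσ).trans (glTreeIso hϖ δ)) hyy' hy hy' x

/-- **EVEN TWISTED SHELLS ARE EMPTY when `τ_δ` inverts an edge**: `{x | d(x, τ_δ x) = 2k} = ∅` (★ `setOf_dist_self_apply_eq_even_of_inversion`). [cite: Serre1980Trees, Ch. I §6.4 Prop. 25] -/
theorem setOf_dist_glVertexAct_thetaTreeIso_eq_even_of_swap (δ : GL (Fin 2) E)
    {y y' : {M : Submodule 𝒪[E] (Fin 2 → E) // IsSpecialLattice (RingHom.id E) ϖ !![(0 : E), 1; -1, 0] M}}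
    (hyy' : (latticeTree (RingHom.id E) ϖ !![(0 : E), 1; -1, 0]).Adj y y')
    (hy : glVertexAct hϖ δ (thetaTreeIso hϖ σ hσv hσσ y) = y') (hy' : glVertexAct hϖ δ (thetaTreeIso hϖ σ hσv hσσ y') = y) (k : ℕ) :
    {x : {M : Submodule 𝒪[E] (Fin 2 → E) // IsSpecialLattice (RingHom.id E) ϖ !![(0 : E), 1; -1, 0] M} |
        (latticeTree (RingHom.id E) ϖ !![(0 : E), 1; -1, 0]).dist x (glVertexAct hϖ δ (thetaTreeIso hϖ σ hσv hσσ x)) = 2 * k} = ∅ :=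
  setOf_dist_self_apply_eq_even_of_inversion (isTree_latticeTree_id_altJ hϖ) ((thetaTreeIso hϖ σ hσv hσσ).trans (glTreeIso hϖ δ)) hyy' hy hy' k

/-- **THE INVERSION TWISTED SHELL COUNT `#{x | d(x, τ_δ x) = 2k+1} = 2·q^k`** on the `(q+1)`-regular tree (★ W8-f′ `ncard_dist_self_apply_eq_odd_of_inversion` BY NAME at
`φ = τ_δ`; regularity as the VALUE BINDER `hdeg`, `q = q_E`, ★ `SLTwoTreeRegular.ncard_neighborSet_eq`) — the `G̃`-side count of `TO_{δθ}(𝟙_{K̃ ϖ^a K̃})`, `a₀ − a₁ = 2k+1`,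
for a twisted class with `ord det δ` odd and elliptic norm. [cite: Rogawski1990, §4.11 pp. 58–60] [cite: Langlands1980AMS96, §5] [cite: Serre1980Trees, Ch. I §6.4 Prop. 25] -/
theorem ncard_setOf_dist_glVertexAct_thetaTreeIso_eq_odd_of_swap
    [(latticeTree (RingHom.id E) ϖ !![(0 : E), 1; -1, 0]).LocallyFinite] (δ : GL (Fin 2) E)
    {y y' : {M : Submodule 𝒪[E] (Fin 2 → E) // IsSpecialLattice (RingHom.id E) ϖ !![(0 : E), 1; -1, 0] M}}
    (hyy' : (latticeTree (RingHom.id E) ϖ !![(0 : E), 1; -1, 0]).Adj y y')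
    (hy : glVertexAct hϖ δ (thetaTreeIso hϖ σ hσv hσσ y) = y') (hy' : glVertexAct hϖ δ (thetaTreeIso hϖ σ hσv hσσ y') = y)
    (q : ℕ) (hdeg : ∀ v : {M : Submodule 𝒪[E] (Fin 2 → E) // IsSpecialLattice (RingHom.id E) ϖ !![(0 : E), 1; -1, 0] M},
      (latticeTree (RingHom.id E) ϖ !![(0 : E), 1; -1, 0]).degree v = q + 1) (k : ℕ) :
    {x : {M : Submodule 𝒪[E] (Fin 2 → E) // IsSpecialLattice (RingHom.id E) ϖ !![(0 : E), 1; -1, 0] M} |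
        (latticeTree (RingHom.id E) ϖ !![(0 : E), 1; -1, 0]).dist x (glVertexAct hϖ δ (thetaTreeIso hϖ σ hσv hσσ x)) = 2 * k + 1}.ncard = 2 * q ^ k :=
  ncard_dist_self_apply_eq_odd_of_inversion (isTree_latticeTree_id_altJ hϖ) ((thetaTreeIso hϖ σ hσv hσσ).trans (glTreeIso hϖ δ)) hyy' hy hy' q hdeg k

end Inversion

end Summit.HodgeConjecture.HodgeConjecture.R90.S6

end
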